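import Literature.Analysis.FluidPDE.ClassicalNSFourierModes
import Literature.Analysis.FluidPDE.TorusClassicalLerayHopfProofs
import Literature.Analysis.FluidPDE.TurbWave0
import Literature.Analysis.FluidPDE.AlexakisDoeringInterpolation

/-!
# The force-moment identity in the mean for classical solutions (solo soloist, blind mode)

Time-dependent companion of `force_sq_eq` (`SoloBlindEnergyFloor.lean`). Test the momentum
equation of a global classical solution of `NS_ν(f)` on `T^d`, `f` smooth, divergence-free and
time-independent, against `f` itself: `d/dt (u(t), f) = ∫⟪u, (u·∇)f⟫ + ν∫⟪u, Δf⟫ + ‖f‖₂²`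
(`Torus.IsClassicalNSSolutionOn.hasDerivWithinAt_integral_inner`). If the energy stays bounded,
`(u(t), f)` is bounded, so dividing by `T`:

* `classical_force_moment_tendsto`: the time means of `∫⟪u, (u·∇)f⟫ + ν∫⟪u, Δf⟫` CONVERGE to
  `-‖f‖₂²` (a limit, not only a `limsup`).

So in every bounded-energy regime — laminar, turbulent, steady or not — the flow is strained against
`∇f` by exactly `‖f‖₂²` on average, up to `O(ν)`: for Kolmogorov forcing `f = (F cos z, 0, 0)` this is
the momentum budget `F = S/L + νŪ/L²` pinning the Reynolds-stress amplitude `S` (Musacchio–Boffetta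
2014, eq. (4); Childress–Kerswell–Gilbert 2001, eq. (9)). What is NOT pinned, and what the zeroth law
(`AnomalousDissipation`) asks for, is the mean shear this stress works against
(`alignment_floor_of_zerothLaw`, `zerothLaw_of_classical_power_floor`).
[cite: Temam1984, Ch. III §1 (1.13)] [cite: MusacchioBoffetta2014, eq. (4)]
-/

open MeasureTheory Filter Topology Set
open scoped ENNReal NNReal InnerProductSpace

noncomputable section

namespace Summit.AnomalousDissipation.AnomalousDissipation.Theorems

open Literature.Analysis.FunctionSpaces Literature.Analysis.FluidPDE

/-- Cauchy–Schwarz for the `L²` pairing of two continuous fields on the torus. [folklore] -/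
private theorem abs_integral_inner_le' {d : Type*} [Fintype d]
    {a b : UnitAddTorus d → EuclideanSpace ℝ d} (ha : Continuous a) (hb : Continuous b) :
    |∫ x, ⟪a x, b x⟫_ℝ| ≤ Real.sqrt (∫ x, ‖a x‖ ^ 2) * Real.sqrt (∫ x, ‖b x‖ ^ 2) := by
  have hE : Integrable (fun x => ‖a x‖ ^ 2) volume :=
    (ha.norm.pow 2).integrable_of_hasCompactSupport (HasCompactSupport.of_compactSpace _)
  have hL : Integrable (fun x => ‖b x‖ ^ 2) volume :=
    (hb.norm.pow 2).integrable_of_hasCompactSupport (HasCompactSupport.of_compactSpace _)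
  rw [← Real.sqrt_mul (integral_nonneg fun x => sq_nonneg _)]
  refine abs_integral_le_integral_abs.trans ?_
  refine integral_le_sqrt_integral_mul_integral (ae_of_all _ fun x => abs_nonneg _)
    (ae_of_all _ fun x => sq_nonneg _) (ae_of_all _ fun x => sq_nonneg _)
    (ae_of_all _ fun x => ?_) (ha.inner hb).abs.aestronglyMeasurable hE hL
  rw [← mul_pow]
  exact pow_le_pow_left₀ (abs_nonneg _) (abs_real_inner_le_norm _ _) 2

/-- **Force-moment identity in the mean** (classical solutions, steady force). For a global
classical solution `(u, p)` of `NS_ν(f)` on `ℝ × T^d` with `f` smooth, divergence-free and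
time-independent, and time-bounded energy `∫‖u(t)‖² ≤ R` (`t ≥ 0`), the time means of the force
moment `∫⟪u, (u·∇)f⟫ + ν ∫⟪u, Δf⟫` converge to `-‖f‖₂²`:
`(1/T)∫₀ᵀ (∫⟪u,(u·∇)f⟫ + ν∫⟪u,Δf⟫) dt → -∫‖f‖²` as `T → ∞`
(integrate `d/dt (u(t),f) = ∫⟪u,(u·∇)f⟫ + ν∫⟪u,Δf⟫ + ‖f‖²` over `[0,T]`, Temam 1984 Ch. III
(1.13), and use `|(u(t), f)| ≤ ‖f‖₂ √R`). [cite: Temam1984, Ch. III §1 (1.13)] -/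
theorem classical_force_moment_tendsto {d : Type*} [Fintype d] [DecidableEq d] {ν : ℝ}
    {f : UnitAddTorus d → EuclideanSpace ℝ d} {u : ℝ → UnitAddTorus d → EuclideanSpace ℝ d}
    {p : ℝ → UnitAddTorus d → ℝ} (h : Torus.IsClassicalNSSolutionOn univ ν (fun _ => f) u p)
    (hf : Torus.IsSmooth f) (hfd : Torus.IsDivFree f)
    (hb : ∃ R : ℝ, ∀ t, 0 ≤ t → ∫ x, ‖u t x‖ ^ 2 ≤ R) :
    Tendsto (fun T => timeMean (fun t => (∫ x, ⟪u t x, Torus.convect (u t) f x⟫_ℝ) +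
      ν * ∫ x, ⟪u t x, Torus.laplacian f x⟫_ℝ) T) atTop (𝓝 (-(∫ x, ‖f x‖ ^ 2))) := by
  obtain ⟨R, hR⟩ := hb
  have hu := h.smooth_velocity
  have hR0 : 0 ≤ R := (integral_nonneg fun x => sq_nonneg _).trans (hR 0 le_rfl)
  -- names
  set M : ℝ → ℝ := fun t => (∫ x, ⟪u t x, Torus.convect (u t) f x⟫_ℝ) +
    ν * ∫ x, ⟪u t x, Torus.laplacian f x⟫_ℝ with hMdef
  set g : ℝ → ℝ := fun t => ∫ x, ⟪u t x, f x⟫_ℝ with hgdef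
  set F2 : ℝ := ∫ x, ‖f x‖ ^ 2 with hF2
  -- the tested momentum equation: `g' = M + ‖f‖²`
  have hff : ∫ x, ⟪f x, f x⟫_ℝ = F2 := by
    simp only [hF2, real_inner_self_eq_norm_sq]
  have hderiv : ∀ t, HasDerivAt g (M t + F2) t := by
    intro t
    have h1 := h.hasDerivWithinAt_integral_inner convex_univ uniqueDiffOn_univ hf hfd (mem_univ t)
    rw [hff] at h1
    exact h1.hasDerivAt univ_mem
  -- continuity of `M`
  have hMc : Continuous M := by
    have hc1 : ContinuousOn (fun t => ∫ x, ⟪u t x, Torus.convect (u t) f x⟫_ℝ) univ :=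
      (hu.inner (hu.convect (Torus.isSmoothSpaceTimeOn_const hf univ) uniqueDiffOn_univ)).continuousOn_integral
        convex_univ
    have hc2 : ContinuousOn (fun t => ∫ x, ⟪u t x, Torus.laplacian f x⟫_ℝ) univ :=
      (hu.inner (Torus.isSmoothSpaceTimeOn_const hf.laplacian univ)).continuousOn_integral convex_univ
    exact (continuousOn_univ.1 hc1).add ((continuousOn_univ.1 hc2).const_smul ν |>.congr
      fun t => by simp [smul_eq_mul])
  -- FTC on `[0, T]`
  have hFTC : ∀ T, 0 ≤ T → ∫ t in (0:ℝ)..T, M t = g T - g 0 - T * F2 := by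
    intro T hT
    have h1 : ∫ t in (0:ℝ)..T, (M t + F2) = g T - g 0 :=
      intervalIntegral.integral_eq_sub_of_hasDerivAt (fun t _ => hderiv t)
        ((hMc.add continuous_const).intervalIntegrable _ _)
    rw [intervalIntegral.integral_add (hMc.intervalIntegrable _ _) intervalIntegrable_const,
      intervalIntegral.integral_const, sub_zero, smul_eq_mul] at h1
    linarith
  -- `g` is bounded: `|g t| ≤ ‖f‖₂ √R`
  set B : ℝ := Real.sqrt R * Real.sqrt F2 with hB
  have hgb : ∀ t, 0 ≤ t → |g t| ≤ B := by
    intro t ht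
    refine (abs_integral_inner_le' (hu.isSmooth_slice (mem_univ t)).continuous hf.continuous).trans ?_
    exact mul_le_mul_of_nonneg_right (Real.sqrt_le_sqrt (hR t ht)) (Real.sqrt_nonneg _)
  -- the boundary term `(g T - g 0)/T → 0`
  have hr : Tendsto (fun T : ℝ => T⁻¹ * (g T - g 0)) atTop (𝓝 0) := by
    have h0 : Tendsto (fun T : ℝ => T⁻¹ * (2 * B)) atTop (𝓝 0) := by
      simpa using tendsto_inv_atTop_zero.mul_const (2 * B)
    refine squeeze_zero_norm' ?_ h0
    filter_upwards [eventually_gt_atTop (0 : ℝ)] with T hT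
    rw [Real.norm_eq_abs, abs_mul, abs_of_pos (inv_pos.2 hT)]
    refine mul_le_mul_of_nonneg_left ?_ (inv_nonneg.2 hT.le)
    calc |g T - g 0| ≤ |g T| + |g 0| := abs_sub _ _
      _ ≤ B + B := add_le_add (hgb T hT.le) (hgb 0 le_rfl)
      _ = 2 * B := by ring
  -- conclude
  have hev : (fun T => timeMean M T) =ᶠ[atTop] fun T => T⁻¹ * (g T - g 0) + -F2 := by
    filter_upwards [eventually_gt_atTop (0 : ℝ)] with T hT
    simp only [timeMean]
    rw [hFTC T hT.le]
    field_simp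
    ring
  rw [tendsto_congr' hev]
  simpa using hr.add_const (-F2)

end Summit.AnomalousDissipation.AnomalousDissipation.Theorems

end
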